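import Literature.Barriers.QuantumAdvantage.FortnowRogersOracle
import Literature.Barriers.QuantumAdvantage.AaronsonChenPH
import Literature.Barriers.QuantumAdvantage.SampPRelSubsetSampBQPRel
import Literature.Barriers.QuantumAdvantage.AaronsonChenSimulationProofs
import Literature.Computability.QuantumComplexity.BPPRelSubsetBQPRel
import Literature.Computability.Complexity.SpaceTMSATHard
import Literature.Computability.QuantumComplexity.CoinFamilyKernelProofs
import Literature.Computability.QuantumComplexity.AccGapMachine
import Literature.Barriers.QuantumAdvantage.AaronsonChenPHUpper
import Literature.Barriers.QuantumAdvantage.AaronsonChenPHLowerBound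
import Literature.Barriers.QuantumAdvantage.CohenGenericJoinPH
import Literature.Barriers.QuantumAdvantage.FortnowRogersBrainWorld
import HarnessLib

/-!
# `SupremacyTheoremsNonRelativizing`: assembly down to the current frontier of named facts

Second proof file (theorems only; D-0014 append protocol) of the barrier entry
`SupremacyTheoremsNonRelativizing.lean` (D-0021),
`SupremacyTheoremsNonRelativizing := fortnowRogers1999_cor37 ∧ fortnowRogers1999_thm42 ∧ aaronsonChen2017_cor52`
(Fortnow–Rogers 1999, Cor. 3.7 and Thm. 4.2 [FortnowRogers1999JCSS]; Aaronson–Chen 2017, Cor. 5.2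
[AaronsonChen2017]). The first proof file `SupremacyTheoremsNonRelativizingProofs.lean` reduces
the barrier fact to six level-1 leaf facts and the oracle-existence hypothesis `h₃` of Cor. 3.7
(`SupremacyTheoremsNonRelativizing.of_parts`) and, its rev. 3 having DISCHARGED the core of
Thm. 4.2 (`fortnowRogers1999_thm42_core_holds`), to five and `h₃` (`.of_parts₆`). Since then the
tree has decomposed every one of those hypotheses further, in files that import the first proof
file (so the composition cannot live there — import cycle):

| level-1 hypothesis | reduced, by proof, to | where |
|---|---|---|
| `BPPRel_ofLanguage_subset_BQPRel` (`BPP^A ⊆ BQP^A`, Bernstein–Vazirani Thm. 8.3 rel.) | `uniformOracleCoinSimulation` | `BPPRel_ofLanguage_subset_BQPRel_of_sim`, `Computability/QuantumComplexity/BPPRelSubsetBQPRel.lean` |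
| `BQPRel_subset_AWPPRel` (`BQP^A ⊆ AWPP^A`, Fortnow–Rogers Thm. 3.1 rel.) | — (itself) | `Computability/QuantumComplexity/CountingSimulationRel.lean` |
| `h₃ : ∃ A, P^A = AWPP^A ∧ PH^A infinite` (the oracle `H ⊕ G` of the proof of Cor. 3.7; an explicit hypothesis, not a named fact) | `fennerFortnowKurtzLi2003_thm618_awpp`, `isInfinitePHRel_join_generic`, `exists_isComplete_PSPACE` (DISCHARGED: `exists_isComplete_PSPACE_holds`, `Complexity/SpaceTMSATHard.lean`) | `exists_oracle_PRel_eq_AWPPRel_infinitePH_of_generic`, `FortnowRogersOracle.lean` |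
| `aaronsonChen2017_thm51_sampBQP_subset` (§5.3) | `aaronsonChen2017_lem53` ← `aaronsonChen2017_lem53_machine` + `aaronsonChen2017_lem53_losses` (DISCHARGED: `aaronsonChen2017_lem53_losses_holds`) | `aaronsonChen2017_thm51_sampBQP_subset_of_lem53` (`AaronsonChenOracleProofs.lean`), `aaronsonChen2017_lem53_of_machine` (`AaronsonChenSimulationProofs.lean`) |
| `SampPRel_subset_SampBQPRel` (`SampBPP^A ⊆ SampBQP^A`) | `uniformOracleCoinSimulation` | `SampPRel_subset_SampBQPRel_of_sim`, `SampPRelSubsetSampBQPRel.lean` |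
| `aaronsonChen2017_thm51_ph` (`PH^{TQBF ⊕ O}` infinite a.s., §5.4) | `sipserOrLang_mem_PHRel`, `sipserOrLang_ae_not_mem_sigmaPRel` | `aaronsonChen2017_thm51_ph_of_parts`, `AaronsonChenPH.lean` |

Main result: `SupremacyTheoremsNonRelativizing.of_frontier` — the barrier fact from the SEVEN
named facts that are the current trust base of the whole entry,

* `uniformOracleCoinSimulation` (`Computability/QuantumComplexity/CoinFamilyKernel.lean`): the
  uniform reversible simulation, with oracle gates, of `FP^A` functions of `⟨x, coins⟩`
  (Bernstein–Vazirani 1997, proof of Thm. 8.3 with §8.3) — it carries `BPP^A ⊆ BQP^A`,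
  `SampBPP^A ⊆ SampBQP^A` and, with the discharged core, the whole of Thm. 4.2
  (`fortnowRogers1999_thm42_of_sim`);
* `BQPRel_subset_AWPPRel` (Fortnow–Rogers 1999, Thm. 3.1 relativized);
* `fennerFortnowKurtzLi2003_thm618_awpp` (Fenner–Fortnow–Kurtz–Li 2003, Thm. 6.18 (2) at a
  `PSPACE`-complete base) and `isInfinitePHRel_join_generic` (the hierarchy is infinite relative
  to `B ⊕ G`, `G` Cohen generic) (`FortnowRogersOracle.lean`);
* `aaronsonChen2017_lem53_machine` (the `SampBPP^{TQBF,O}` simulator of Lemma 5.3,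
  `AaronsonChenSimulation.lean`);
* `sipserOrLang_mem_PHRel` and `sipserOrLang_ae_not_mem_sigmaPRel` (the two halves of the
  `PH`–`AC⁰` connection for `Sipser_d ∘ OR`, `AaronsonChenPH.lean`; the second is the content of
  §5.4 via Rossman–Servedio–Tan),

together with the conjunct-level assemblies `fortnowRogers1999_cor37_of_frontier` and
`aaronsonChen2017_cor52_of_frontier`. `SupremacyTheoremsNonRelativizing_holds` is
`SupremacyTheoremsNonRelativizing.of_frontier` applied to the seven `_holds` once they exist.
Nothing is restated: every leaf and every reduction is imported and used at its tree name.

## Sources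

* [FortnowRogers1999JCSS] L. Fortnow, J. Rogers, *Complexity limitations on quantum computation*,
  JCSS 59 (1999) (arXiv:cs/9811023, held; arXiv numbering): Thm. 3.1, Thm. 3.6, Cor. 3.7 (p. 5),
  Thm. 4.2 and its proof (p. 7).
* [AaronsonChen2017] S. Aaronson, L. Chen, *Complexity-theoretic foundations of quantum supremacy
  experiments*, CCC 2017 (arXiv:1612.05903, held): Thm. 5.1, Cor. 5.2, Lemma 5.3 (p. 21), §5.3
  (pp. 21–23), §5.4 (p. 24).
* [FennerFortnowKurtzLi2003IC] S. Fenner, L. Fortnow, S. Kurtz, L. Li, *An oracle builder's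
  toolkit*, Inform. and Comput. 182 (2003): Thm. 6.18 (2) (p. 33) and pp. 33–34.
* [BernsteinVazirani1997SICOMP] E. Bernstein, U. Vazirani, *Quantum complexity theory*, SIAM J.
  Comput. 26 (1997): Thm. 8.3 (p. 1451), §8.3.
-/

noncomputable section

namespace Literature.Barriers.QuantumAdvantage

open _root_.Computability Literature.Computability.Complexity Literature.Computability.Complexity.Classes
  Literature.Computability.Cryptography Literature.Computability.QuantumComplexity

/-- **Fortnow–Rogers Cor. 3.7 from the current frontier**: `P^A = BQP^A` with `PH^A` infinite at
`A = B ⊕ G` (`B` `PSPACE`-complete — the tree's `SPACETMSAT`, `exists_isComplete_PSPACE_holds` —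
and `G` generic for the two countable families), from the reversible-simulation fact
(`BPP^A ⊆ BQP^A` via `BPPRel_ofLanguage_subset_BQPRel_of_sim`), `BQP^A ⊆ AWPP^A`, and the two
genericity facts of `FortnowRogersOracle.lean`.
[cite: FortnowRogers1999JCSS, Cor. 3.7 and its proof, §3 p. 5 (arXiv numbering)] [cite: FennerFortnowKurtzLi2003IC, Thm. 6.18 (2) and pp. 33–34] -/
theorem fortnowRogers1999_cor37_of_frontier (hsim : uniformOracleCoinSimulation)
    (hAW : BQPRel_subset_AWPPRel) (h618 : fennerFortnowKurtzLi2003_thm618_awpp)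
    (hPH : isInfinitePHRel_join_generic) : fortnowRogers1999_cor37 :=
  fortnowRogers1999_cor37_of_generic (BPPRel_ofLanguage_subset_BQPRel_of_sim hsim) hAW h618 hPH
    exists_isComplete_PSPACE_holds

/-- **Aaronson–Chen Cor. 5.2 from the current frontier**: the `SampBPP^{TQBF,O}` machine of
Lemma 5.3 (its probabilistic analysis being discharged, `aaronsonChen2017_lem53_of_machine`), the
reversible-simulation fact (`SampBPP^A ⊆ SampBQP^A` via `SampPRel_subset_SampBQPRel_of_sim`) and the
two halves of the `PH`–`AC⁰` connection for `Sipser_d ∘ OR` (`aaronsonChen2017_thm51_ph_of_parts`).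
[cite: AaronsonChen2017, Thm. 5.1, Cor. 5.2 and Lemma 5.3 (p. 21), §5.4 (p. 24)] -/
theorem aaronsonChen2017_cor52_of_frontier (hsim : uniformOracleCoinSimulation)
    (hM : aaronsonChen2017_lem53_machine) (hU : sipserOrLang_mem_PHRel)
    (hL : sipserOrLang_ae_not_mem_sigmaPRel) : aaronsonChen2017_cor52 :=
  aaronsonChen2017_cor52_of_leaves (aaronsonChen2017_lem53_of_machine hM) hsim
    (aaronsonChen2017_thm51_ph_of_parts hU hL)

/-- **`SupremacyTheoremsNonRelativizing` from the current frontier of seven named facts** (the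
core of Thm. 4.2, the existence of a `PSPACE`-complete set, the losses analysis of Lemma 5.3 and
`P^O ⊆ BPP^O` all being discharged in the tree): via `SupremacyTheoremsNonRelativizing.of_parts₆`.
[cite: FortnowRogers1999JCSS, Cor. 3.7 and Thm. 4.2 (arXiv numbering)] [cite: AaronsonChen2017, Cor. 5.2 (p. 21)] -/
theorem SupremacyTheoremsNonRelativizing.of_frontier (hsim : uniformOracleCoinSimulation)
    (hAW : BQPRel_subset_AWPPRel) (h618 : fennerFortnowKurtzLi2003_thm618_awpp)
    (hPH : isInfinitePHRel_join_generic) (hM : aaronsonChen2017_lem53_machine)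
    (hU : sipserOrLang_mem_PHRel) (hL : sipserOrLang_ae_not_mem_sigmaPRel) :
    SupremacyTheoremsNonRelativizing :=
  SupremacyTheoremsNonRelativizing.of_parts₆ (BPPRel_ofLanguage_subset_BQPRel_of_sim hsim) hAW
    (exists_oracle_PRel_eq_AWPPRel_infinitePH_of_generic h618 hPH exists_isComplete_PSPACE_holds)
    (aaronsonChen2017_thm51_sampBQP_subset_of_lem53 (aaronsonChen2017_lem53_of_machine hM))
    (SampPRel_subset_SampBQPRel_of_sim hsim) (aaronsonChen2017_thm51_ph_of_parts hU hL)

/-- The same assembly, conjunct by conjunct (definitional unfolding of the barrier fact).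
[cite: FortnowRogers1999JCSS, Cor. 3.7 and Thm. 4.2 (arXiv numbering)] [cite: AaronsonChen2017, Cor. 5.2 (p. 21)] -/
theorem SupremacyTheoremsNonRelativizing.of_frontier' (hsim : uniformOracleCoinSimulation)
    (hAW : BQPRel_subset_AWPPRel) (h618 : fennerFortnowKurtzLi2003_thm618_awpp)
    (hPH : isInfinitePHRel_join_generic) (hM : aaronsonChen2017_lem53_machine)
    (hU : sipserOrLang_mem_PHRel) (hL : sipserOrLang_ae_not_mem_sigmaPRel) :
    fortnowRogers1999_cor37 ∧ fortnowRogers1999_thm42 ∧ aaronsonChen2017_cor52 :=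
  ⟨fortnowRogers1999_cor37_of_frontier hsim hAW h618 hPH, fortnowRogers1999_thm42_of_sim hsim,
    aaronsonChen2017_cor52_of_frontier hsim hM hU hL⟩

/-! ### Revision 2 (2026-08-15): two frontier facts discharged — `uniformOracleCoinSimulation_holds` (`QuantumComplexity/CoinFamilyKernelProofs.lean`) and `BQPRel_subset_AWPPRel_holds` (`QuantumComplexity/AccGapMachine.lean`) -/

/-- **Fortnow–Rogers 1999, Thm. 4.2 — DISCHARGED**: there is an oracle `C` with
`P^C = BPP^C = BQP^C ≠ UP^C ∩ coUP^C`. The core (`fortnowRogers1999_thm42_core_holds`, brain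
oracle joined with a `UP ∩ coUP`-diagonal generic) was discharged in rev. 3 of the first proof
file; the remaining leaf `BPP^A ⊆ BQP^A` follows from the relativized coin simulation
`uniformOracleCoinSimulation_holds` (`fortnowRogers1999_thm42_of_sim`). Second conjunct of the
barrier fact. [cite: FortnowRogers1999JCSS, Thm. 4.2 and its proof, p. 7 (arXiv numbering)] -/
theorem fortnowRogers1999_thm42_holds : fortnowRogers1999_thm42 :=
  fortnowRogers1999_thm42_of_sim uniformOracleCoinSimulation_holds

/-- **Cor. 3.7 down to the two generic-oracle facts**: with `P^A ⊆ BQP^A` (coin simulation) and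
`BQP^A ⊆ AWPP^A` (`BQPRel_subset_AWPPRel_holds`: the relativized path-pair count,
`AccGapMachine.lean`) discharged, the relativized world with `P = BQP` and an infinite hierarchy
needs only Fenner–Fortnow–Kurtz–Li Thm. 6.18 (2) and the generic separation of `PH`.
[cite: FortnowRogers1999JCSS, Cor. 3.7 and §3 (arXiv numbering)] -/
theorem fortnowRogers1999_cor37_of₂ (h618 : fennerFortnowKurtzLi2003_thm618_awpp) (hPH : isInfinitePHRel_join_generic) :
    fortnowRogers1999_cor37 :=
  fortnowRogers1999_cor37_of_frontier uniformOracleCoinSimulation_holds BQPRel_subset_AWPPRel_holds h618 hPH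

/-- **Cor. 5.2 down to three facts**: the `PSPACE` sampler of Lemma 5.3 and the two halves of the
`PH^{TQBF,O}`-infinite-a.s. statement. [cite: AaronsonChen2017, Cor. 5.2 (p. 21), Thm. 5.1, §5.3–5.4] -/
theorem aaronsonChen2017_cor52_of₃ (hM : aaronsonChen2017_lem53_machine) (hU : sipserOrLang_mem_PHRel)
    (hL : sipserOrLang_ae_not_mem_sigmaPRel) : aaronsonChen2017_cor52 :=
  aaronsonChen2017_cor52_of_frontier uniformOracleCoinSimulation_holds hM hU hL

/-- **The barrier fact from the five remaining frontier facts** (2026-08-15): Fenner–Fortnow–Kurtz–Li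
Thm. 6.18 (2) (`fennerFortnowKurtzLi2003_thm618_awpp`), the generic separation of the relativized
hierarchy (`isInfinitePHRel_join_generic`), the `PSPACE^{TQBF}` sampler of Aaronson–Chen Lemma 5.3
(`aaronsonChen2017_lem53_machine`), and the two halves of "`PH^{TQBF,O}` is infinite with
probability 1" (`sipserOrLang_mem_PHRel`, `sipserOrLang_ae_not_mem_sigmaPRel`); the discharge
`SupremacyTheoremsNonRelativizing_holds` is this theorem applied to their five `_holds`.
[cite: FortnowRogers1999JCSS, Cor. 3.7 and Thm. 4.2 (arXiv numbering)] [cite: AaronsonChen2017, Cor. 5.2 (p. 21)] -/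
theorem SupremacyTheoremsNonRelativizing.of_frontier₅ (h618 : fennerFortnowKurtzLi2003_thm618_awpp)
    (hPH : isInfinitePHRel_join_generic) (hM : aaronsonChen2017_lem53_machine) (hU : sipserOrLang_mem_PHRel)
    (hL : sipserOrLang_ae_not_mem_sigmaPRel) : SupremacyTheoremsNonRelativizing :=
  SupremacyTheoremsNonRelativizing.of_frontier uniformOracleCoinSimulation_holds BQPRel_subset_AWPPRel_holds h618 hPH hM hU hL

/-- The same, conjunct by conjunct. [cite: FortnowRogers1999JCSS, Cor. 3.7 and Thm. 4.2 (arXiv numbering)] [cite: AaronsonChen2017, Cor. 5.2 (p. 21)] -/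
theorem SupremacyTheoremsNonRelativizing.of_frontier₅' (h618 : fennerFortnowKurtzLi2003_thm618_awpp)
    (hPH : isInfinitePHRel_join_generic) (hM : aaronsonChen2017_lem53_machine) (hU : sipserOrLang_mem_PHRel)
    (hL : sipserOrLang_ae_not_mem_sigmaPRel) :
    fortnowRogers1999_cor37 ∧ fortnowRogers1999_thm42 ∧ aaronsonChen2017_cor52 :=
  ⟨fortnowRogers1999_cor37_of₂ h618 hPH, fortnowRogers1999_thm42_holds, aaronsonChen2017_cor52_of₃ hM hU hL⟩


/-! ### Revision 3 (2026-08-15): a third frontier fact discharged — `sipserOrLang_mem_PHRel_holds` (`AaronsonChenPHUpper.lean`)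

(The conditional form "`aaronsonChen2017_thm51_ph` from `sipserOrLang_ae_not_mem_sigmaPRel` alone" that this revision
used to record was removed on 2026-08-15 as a duplicate: since rev. 4 the unconditional
`aaronsonChen2017_thm51_ph_holds` (`AaronsonChenPHLowerBound.lean`) proves its conclusion outright — use that.) -/

/-- **Cor. 5.2 down to two facts**: the `PSPACE^{TQBF}` sampler of Lemma 5.3 and the almost-sure
lower bound of §5.4. [cite: AaronsonChen2017, Cor. 5.2 (p. 21), Thm. 5.1, §5.3–5.4] -/
theorem aaronsonChen2017_cor52_of₂ (hM : aaronsonChen2017_lem53_machine) (hL : sipserOrLang_ae_not_mem_sigmaPRel) :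
    aaronsonChen2017_cor52 :=
  aaronsonChen2017_cor52_of₃ hM sipserOrLang_mem_PHRel_holds hL

/-- **The barrier fact from the four remaining frontier facts** (2026-08-15, rev. 3):
Fenner–Fortnow–Kurtz–Li Thm. 6.18 (2) (`fennerFortnowKurtzLi2003_thm618_awpp`), the generic
separation of the relativized hierarchy (`isInfinitePHRel_join_generic`), the `PSPACE^{TQBF}`
sampler of Aaronson–Chen Lemma 5.3 (`aaronsonChen2017_lem53_machine`) and the almost-sure lower
bound "`Sipser_{k+3} ∘ OR ∉ Σₖ^{A ⊕ O}`" (`sipserOrLang_ae_not_mem_sigmaPRel`); the discharge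
`SupremacyTheoremsNonRelativizing_holds` is this theorem applied to their four `_holds`.
[cite: FortnowRogers1999JCSS, Cor. 3.7 and Thm. 4.2 (arXiv numbering)] [cite: AaronsonChen2017, Cor. 5.2 (p. 21)] -/
theorem SupremacyTheoremsNonRelativizing.of_frontier₄ (h618 : fennerFortnowKurtzLi2003_thm618_awpp)
    (hPH : isInfinitePHRel_join_generic) (hM : aaronsonChen2017_lem53_machine)
    (hL : sipserOrLang_ae_not_mem_sigmaPRel) : SupremacyTheoremsNonRelativizing :=
  SupremacyTheoremsNonRelativizing.of_frontier₅ h618 hPH hM sipserOrLang_mem_PHRel_holds hL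

/-- The same, conjunct by conjunct. [cite: FortnowRogers1999JCSS, Cor. 3.7 and Thm. 4.2 (arXiv numbering)] [cite: AaronsonChen2017, Cor. 5.2 (p. 21)] -/
theorem SupremacyTheoremsNonRelativizing.of_frontier₄' (h618 : fennerFortnowKurtzLi2003_thm618_awpp)
    (hPH : isInfinitePHRel_join_generic) (hM : aaronsonChen2017_lem53_machine)
    (hL : sipserOrLang_ae_not_mem_sigmaPRel) :
    fortnowRogers1999_cor37 ∧ fortnowRogers1999_thm42 ∧ aaronsonChen2017_cor52 :=
  ⟨fortnowRogers1999_cor37_of₂ h618 hPH, fortnowRogers1999_thm42_holds, aaronsonChen2017_cor52_of₂ hM hL⟩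


/-! ### Revision 4 (2026-08-15): two more frontier facts discharged — `isInfinitePHRel_join_generic_holds` (`CohenGenericJoinPH.lean`) and `sipserOrLang_ae_not_mem_sigmaPRel_holds` (`AaronsonChenPHLowerBound.lean`) -/

/-! (The conditional form "Cor. 3.7 down to ONE fact" — `fortnowRogers1999_cor37` from
`fennerFortnowKurtzLi2003_thm618_awpp` alone, the generic separation of the relativized hierarchy
being proved (`isInfinitePHRel_join_generic_holds`) — that this revision used to record under the
name `fortnowRogers1999_cor37_of₁` was removed on 2026-08-15 as a duplicate: since rev. 5 the
unconditional `fortnowRogers1999_cor37_holds` (`FortnowRogersBrainWorld.lean`) proves its conclusion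
outright — use that; the printed `B ⊕ G` route from Fenner–Fortnow–Kurtz–Li Thm. 6.18 (2) is the term
`fortnowRogers1999_cor37_of₂ h618 isInfinitePHRel_join_generic_holds`.) -/

/-- **Cor. 5.2 down to ONE fact**: with both halves of "`PH^{TQBF ⊕ O}` is infinite with
probability 1" proved (`aaronsonChen2017_thm51_ph_holds`), Aaronson–Chen's Cor. 5.2 rests only
on the `PSPACE^{TQBF}` sampler of Lemma 5.3 (`aaronsonChen2017_lem53_machine`).
[cite: AaronsonChen2017, Cor. 5.2 (p. 21), Thm. 5.1, §5.3–5.4] -/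
theorem aaronsonChen2017_cor52_of₁ (hM : aaronsonChen2017_lem53_machine) : aaronsonChen2017_cor52 :=
  aaronsonChen2017_cor52_of₂ hM sipserOrLang_ae_not_mem_sigmaPRel_holds

/-- **The barrier fact from the two remaining frontier facts** (2026-08-15, rev. 4):
Fenner–Fortnow–Kurtz–Li Thm. 6.18 (2) (`fennerFortnowKurtzLi2003_thm618_awpp`) and the
`PSPACE^{TQBF}` sampler of Aaronson–Chen Lemma 5.3 (`aaronsonChen2017_lem53_machine`); the
discharge `SupremacyTheoremsNonRelativizing_holds` is this theorem applied to their two `_holds`.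
[cite: FortnowRogers1999JCSS, Cor. 3.7 and Thm. 4.2 (arXiv numbering)] [cite: AaronsonChen2017, Cor. 5.2 (p. 21)] -/
theorem SupremacyTheoremsNonRelativizing.of_frontier₂ (h618 : fennerFortnowKurtzLi2003_thm618_awpp)
    (hM : aaronsonChen2017_lem53_machine) : SupremacyTheoremsNonRelativizing :=
  SupremacyTheoremsNonRelativizing.of_frontier₄ h618 isInfinitePHRel_join_generic_holds hM
    sipserOrLang_ae_not_mem_sigmaPRel_holds

/-- The same, conjunct by conjunct (the middle conjunct, Fortnow–Rogers Thm. 4.2, is a theorem of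
the tree outright; the first is Cor. 3.7 by the printed `B ⊕ G` route, `fortnowRogers1999_cor37_of₂`
fed with Fenner–Fortnow–Kurtz–Li Thm. 6.18 (2) and `isInfinitePHRel_join_generic_holds`).
[cite: FortnowRogers1999JCSS, Cor. 3.7 and Thm. 4.2 (arXiv numbering)] [cite: AaronsonChen2017, Cor. 5.2 (p. 21)] -/
theorem SupremacyTheoremsNonRelativizing.of_frontier₂' (h618 : fennerFortnowKurtzLi2003_thm618_awpp)
    (hM : aaronsonChen2017_lem53_machine) :
    fortnowRogers1999_cor37 ∧ fortnowRogers1999_thm42 ∧ aaronsonChen2017_cor52 :=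
  ⟨fortnowRogers1999_cor37_of₂ h618 isInfinitePHRel_join_generic_holds, fortnowRogers1999_thm42_holds,
    aaronsonChen2017_cor52_of₁ hM⟩


/-! ### Revision 5 (2026-08-15): Fortnow–Rogers Cor. 3.7 is a theorem of the tree (`fortnowRogers1999_cor37_holds`, `FortnowRogersBrainWorld.lean`: a brain oracle joined with a Cohen generic in place of the printed `H ⊕ G`) — the barrier fact from the ONE remaining frontier fact -/

/-- **The three conjuncts from the ONE remaining frontier fact**, conjunct by conjunct:
Fortnow–Rogers Cor. 3.7 (`fortnowRogers1999_cor37_holds`, `FortnowRogersBrainWorld.lean`: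
`P = BQP = AWPP` with an infinite hierarchy relative to a brain oracle joined with a Cohen generic —
the printed architecture of Cor. 3.7, the certificate search of Fenner–Fortnow–Kurtz–Li's Standard
Algorithm supplied by the brain) and Thm. 4.2 (`fortnowRogers1999_thm42_holds`) are theorems of the
tree outright; only Aaronson–Chen Cor. 5.2 still takes the `PSPACE^{TQBF}` sampler of Lemma 5.3
(`aaronsonChen2017_lem53_machine`, via `aaronsonChen2017_cor52_of₁`). (The PRINTED witness of
Cor. 3.7, `B ⊕ G` with `B` `PSPACE`-complete, is `fortnowRogers1999_cor37_of₂` applied to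
Fenner–Fortnow–Kurtz–Li Thm. 6.18 (2), the named fact `fennerFortnowKurtzLi2003_thm618_awpp`, and
`isInfinitePHRel_join_generic_holds`.)
[cite: FortnowRogers1999JCSS, Cor. 3.7 and Thm. 4.2 (arXiv numbering)] [cite: AaronsonChen2017, Cor. 5.2 (p. 21) and Lemma 5.3] -/
theorem SupremacyTheoremsNonRelativizing.of_frontier₁' (hM : aaronsonChen2017_lem53_machine) :
    fortnowRogers1999_cor37 ∧ fortnowRogers1999_thm42 ∧ aaronsonChen2017_cor52 :=
  ⟨fortnowRogers1999_cor37_holds, fortnowRogers1999_thm42_holds, aaronsonChen2017_cor52_of₁ hM⟩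

/-- **The barrier fact from the ONE remaining frontier fact** (2026-08-15, rev. 5): the
`PSPACE^{TQBF}` sampler of Aaronson–Chen Lemma 5.3 (`aaronsonChen2017_lem53_machine`); the
discharge `SupremacyTheoremsNonRelativizing_holds` is this theorem applied to its `_holds` once it
exists. [cite: FortnowRogers1999JCSS, Cor. 3.7 and Thm. 4.2 (arXiv numbering)] [cite: AaronsonChen2017, Cor. 5.2 (p. 21) and Lemma 5.3] -/
theorem SupremacyTheoremsNonRelativizing.of_frontier₁ (hM : aaronsonChen2017_lem53_machine) :
    SupremacyTheoremsNonRelativizing :=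
  SupremacyTheoremsNonRelativizing.of_frontier₁' hM


end Literature.Barriers.QuantumAdvantage

end
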